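import Literature.Topology.FourManifolds.Rasmussen
import Literature.Topology.FourManifolds.SliceDiscInTransport
import Literature.Topology.FourManifolds.HomotopyBallSliceSphereProofs
import Literature.Topology.FourManifolds.SphereSimplyConnected
import Literature.Barriers.SmoothPoincare4.GluckTwistsDissolve
import Literature.Uncategorized.Crux
import Summits.SmoothPoincare4.SmoothPoincare4.Theorems.ZseSVanishesOnPairs.Negative.Targets

/-!
# Height zero of line `embed-dont-dissolve` is the kill switch; Schoenflies spheres are useless (negative lemmas for crux stmt-SmoothPoincare4-0368)

Crux `ZeroSurgeryExotic.ZseSVanishesOnPairs` (item `stmt-SmoothPoincare4-0368`) = the tree's registered open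
statement `Literature.Uncategorized.SVanishesOnPairs`.  The lead's picked line `embed-dont-dissolve`
(skeleton `Cruxes/ZseSVanishesOnPairs/Lines/embed-dont-dissolve.lean`) bets that the punctured
Manolescu–Piccirillo pair sphere `X ∖ {q}` of every `0`-surgery pair embeds, orientation-correctly, in a
`ℂℙ²`-tower `#ⁿ(ℂℙ², o)` of ONE chirality (`stub_puncturedPairSphereEmbeds`); height `n = 0` means a
target `P ≅ S⁴`.  This file (standing disprover, gen 3) closes the position of the HEIGHT-ZERO case from
both sides, unconditionally and over tree vocabulary only (no definitions; the puncture is the open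
submanifold `⟨{q}ᶜ, isOpen_compl_singleton⟩` exactly as in the skeleton's `stub_sliceDiscIn_transport_puncture`):

* `isSmoothlySlice_of_isSliceDiscIn_of_punctureEmbeds` (LEMMA S) — slice data `K.IsSliceDiscIn X e f` in ANY
  smooth 4-manifold `X` plus a smooth embedding of some puncture `X ∖ {q}` (off the ball and the disc) into a
  4-manifold diffeomorphic to `S⁴` force `K` to be smoothly slice: corestrict (`IsSliceDiscIn.codRestrict`),
  transport (`IsSliceDiscIn.comp_isSmoothEmbedding`), Palais (`isSmoothlySlice_of_isSliceDiscIn_of_diffeomorph_sphere`,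
  Negative/Targets).  Consequence (paper): a knot slice in a Schoenflies ball `B ⊂ S⁴` is slice — take
  `X = B ∪_∂ B⁴` punctured inside the cap — with no appeal to the smooth Schoenflies conjecture;
* `zeroSurgeryDeterminesSliceness_of_heightZeroBet` / `heightZeroBet_of_zeroSurgeryDeterminesSliceness` —
  the bet frozen at height `0` (orientations dropped, ambient arbitrary) is EQUIVALENT to the route's kill
  switch "the `0`-surgery type determines sliceness" (body of route item `Assembly2`, spelled out), hence
  refutable by exactly the route's thesis and by nothing less: the line's content is the passage to height `≥ 1`;
* `exists_isSliceDiscIn_punctureEmbeds_iff_isSmoothlySlice` — "slice in an ambient with an `S⁴`-embeddable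
  puncture" ⟺ slice (`Knot.IsHomotopyBallSlice` is this statement minus the embeddability: the open notion);
* `not_sVanishesOnPairs_witness_not_schoenflies` — given Rasmussen's Theorem 1, a counterexample to the crux
  has `K'` slice only in ambients NO puncture of which embeds in `S⁴` (its MP sphere is an exotic `S⁴` not
  of Schoenflies type `B ∪ B⁴`);
* `fgmwRasmussenStrategy_sphere_not_schoenflies` — the same for the registered open `FGMWRasmussenStrategy`.
-/

noncomputable section

set_option linter.dupNamespace false

open scoped Manifold ContDiff Topology
open Set Function
open Literature.Topology.FourManifolds Literature.Uncategorized

namespace Summit.SmoothPoincare4.SmoothPoincare4.Theorems.ZseSVanishesOnPairs.Negative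

/-- **LEMMA S (Schoenflies spheres are useless for H-sliceness).**  If `K` bounds a smooth proper disc
off a ball in a smooth 4-manifold `X` (`K.IsSliceDiscIn X e f`) and some puncture `X ∖ {q}` off the ball
and the disc embeds smoothly in a 4-manifold `P` diffeomorphic to `S⁴`, then `K` is smoothly slice.
No hypothesis on `X` beyond smoothness.  [cite: Palais1960, Thm. B] -/
theorem isSmoothlySlice_of_isSliceDiscIn_of_punctureEmbeds {K : Knot} {X : Type} [TopologicalSpace X]
    [T2Space X] [ChartedSpace (EuclideanSpace ℝ (Fin 4)) X] [IsManifold (𝓡 4) ∞ X]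
    {e : EuclideanSpace ℝ (Fin 4) → X} {f : EuclideanSpace ℝ (Fin 2) → X} (h : K.IsSliceDiscIn X e f)
    {q : X} (hqe : q ∉ range e) (hqf : q ∉ range f) {P : Type} [TopologicalSpace P]
    [ChartedSpace (EuclideanSpace ℝ (Fin 4)) P] [IsManifold (𝓡 4) ∞ P]
    (φ : P ≃ₘ⟮𝓡 4, 𝓡 4⟯ Metric.sphere (0 : EuclideanSpace ℝ (Fin 5)) 1)
    {j : ↥((⟨{q}ᶜ, isOpen_compl_singleton⟩ : TopologicalSpace.Opens X)) → P}
    (hj : Manifold.IsSmoothEmbedding (𝓡 4) (𝓡 4) ∞ j) : K.IsSmoothlySlice := by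
  have heU : ∀ v, e v ∈ (⟨{q}ᶜ, isOpen_compl_singleton⟩ : TopologicalSpace.Opens X) := by
    intro v (hv : e v ∈ ({q} : Set X))
    exact hqe ⟨v, hv⟩
  have hfU : ∀ y, f y ∈ (⟨{q}ᶜ, isOpen_compl_singleton⟩ : TopologicalSpace.Opens X) := by
    intro y (hy : f y ∈ ({q} : Set X))
    exact hqf ⟨y, hy⟩
  exact isSmoothlySlice_of_isSliceDiscIn_of_diffeomorph_sphere
    ((h.codRestrict _ heU hfU).comp_isSmoothEmbedding hj) φ

/-- **LEMMA S for `S⁴` itself.** [cite: Palais1960, Thm. B] -/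
theorem isSmoothlySlice_of_isSliceDiscIn_of_punctureEmbeds_sphere {K : Knot} {X : Type}
    [TopologicalSpace X] [T2Space X] [ChartedSpace (EuclideanSpace ℝ (Fin 4)) X] [IsManifold (𝓡 4) ∞ X]
    {e : EuclideanSpace ℝ (Fin 4) → X} {f : EuclideanSpace ℝ (Fin 2) → X} (h : K.IsSliceDiscIn X e f)
    {q : X} (hqe : q ∉ range e) (hqf : q ∉ range f)
    {ι : ↥((⟨{q}ᶜ, isOpen_compl_singleton⟩ : TopologicalSpace.Opens X)) →
      Metric.sphere (0 : EuclideanSpace ℝ (Fin 5)) 1}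
    (hι : Manifold.IsSmoothEmbedding (𝓡 4) (𝓡 4) ∞ ι) : K.IsSmoothlySlice :=
  isSmoothlySlice_of_isSliceDiscIn_of_punctureEmbeds h hqe hqf (Diffeomorph.refl _ _ _) hι

/-- Contrapositive: **a non-slice knot is slice only in ambients no puncture of which embeds in `S⁴`.**
[cite: FreedmanGompfMorrisonWalker2010, §1] -/
theorem not_punctureEmbeds_sphere_of_not_isSmoothlySlice {K : Knot} (hK : ¬ K.IsSmoothlySlice)
    {X : Type} [TopologicalSpace X] [T2Space X] [ChartedSpace (EuclideanSpace ℝ (Fin 4)) X]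
    [IsManifold (𝓡 4) ∞ X] {e : EuclideanSpace ℝ (Fin 4) → X} {f : EuclideanSpace ℝ (Fin 2) → X}
    (h : K.IsSliceDiscIn X e f) {q : X} (hqe : q ∉ range e) (hqf : q ∉ range f)
    (ι : ↥((⟨{q}ᶜ, isOpen_compl_singleton⟩ : TopologicalSpace.Opens X)) →
      Metric.sphere (0 : EuclideanSpace ℝ (Fin 5)) 1) :
    ¬ Manifold.IsSmoothEmbedding (𝓡 4) (𝓡 4) ∞ ι :=
  fun hι ↦ hK (isSmoothlySlice_of_isSliceDiscIn_of_punctureEmbeds_sphere h hqe hqf hι)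

/-- **A slice knot is slice in `S⁴` off a round ball, with data missing a point, the puncture embedding in
`S⁴` by the inclusion** (`IsSliceDisc.isSliceDiscIn_sphere`, `IsSliceDiscIn.exists_notMem_range`,
`Manifold.IsSmoothEmbedding.of_opens`). [cite: ManolescuPiccirillo2023, §2 (remark after Def. 2.1)] -/
theorem exists_punctureEmbeds_of_isSmoothlySlice {K : Knot} (hK : K.IsSmoothlySlice) :
    ∃ (X : Type) (_ : TopologicalSpace X) (_ : T2Space X) (_ : ChartedSpace (EuclideanSpace ℝ (Fin 4)) X)
      (_ : IsManifold (𝓡 4) ∞ X) (e : EuclideanSpace ℝ (Fin 4) → X) (f : EuclideanSpace ℝ (Fin 2) → X)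
      (q : X) (ι : ↥((⟨{q}ᶜ, isOpen_compl_singleton⟩ : TopologicalSpace.Opens X)) →
        Metric.sphere (0 : EuclideanSpace ℝ (Fin 5)) 1),
      K.IsSliceDiscIn X e f ∧ q ∉ range e ∧ q ∉ range f ∧ Manifold.IsSmoothEmbedding (𝓡 4) (𝓡 4) ∞ ι := by
  obtain ⟨g, hg⟩ := hK
  let a : Metric.sphere (0 : EuclideanSpace ℝ (Fin 5)) 1 := ⟨EuclideanSpace.single 0 1, by simp⟩
  have h0 := hg.isSliceDiscIn_sphere a
  haveI : SimplyConnectedSpace (Metric.sphere (0 : EuclideanSpace ℝ (Fin 5)) 1) :=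
    simplyConnectedSpace_sphere_four_holds
  obtain ⟨φ, e', -, h', -, hqe, hqf⟩ := h0.exists_notMem_range a
  exact ⟨_, _, inferInstance, _, inferInstance, _, _, a, Subtype.val, h', hqe, hqf,
    Manifold.IsSmoothEmbedding.of_opens _⟩

/-- **"Slice in an ambient with an `S⁴`-embeddable puncture" ⟺ slice.** Unconditional; the OPEN notion
`Knot.IsHomotopyBallSlice` is this one without the embeddability clause. [cite: Palais1960, Thm. B] -/
theorem exists_isSliceDiscIn_punctureEmbeds_iff_isSmoothlySlice (K : Knot) :
    (∃ (X : Type) (_ : TopologicalSpace X) (_ : T2Space X) (_ : ChartedSpace (EuclideanSpace ℝ (Fin 4)) X)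
      (_ : IsManifold (𝓡 4) ∞ X) (e : EuclideanSpace ℝ (Fin 4) → X) (f : EuclideanSpace ℝ (Fin 2) → X)
      (q : X) (ι : ↥((⟨{q}ᶜ, isOpen_compl_singleton⟩ : TopologicalSpace.Opens X)) →
        Metric.sphere (0 : EuclideanSpace ℝ (Fin 5)) 1),
      K.IsSliceDiscIn X e f ∧ q ∉ range e ∧ q ∉ range f ∧ Manifold.IsSmoothEmbedding (𝓡 4) (𝓡 4) ∞ ι) ↔
    K.IsSmoothlySlice := by
  constructor
  · rintro ⟨X, _, _, _, _, e, f, q, ι, hef, hqe, hqf, hι⟩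
    exact isSmoothlySlice_of_isSliceDiscIn_of_punctureEmbeds_sphere hef hqe hqf hι
  · exact exists_punctureEmbeds_of_isSmoothlySlice

/-- **HEIGHT-ZERO BET ⇒ KILL SWITCH.**  If on every `0`-surgery pair `(K, K')` with `K` smoothly slice the
knot `K'` bounds a disc off a ball in SOME smooth 4-manifold with an `S⁴`-embeddable puncture (the line's bet
at tower height `0`, orientations dropped, ambient arbitrary), then the `0`-surgery type determines smooth
sliceness (the body of route item `Assembly2`, spelled out).  Unconditional. [folklore] -/
theorem zeroSurgeryDeterminesSliceness_of_heightZeroBet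
    (h : ∀ (K K' : Knot) (Y : Type) [TopologicalSpace Y] [ChartedSpace (EuclideanSpace ℝ (Fin 3)) Y],
      IsIntegralSurgery (𝓡 3) Y K 0 → IsIntegralSurgery (𝓡 3) Y K' 0 → K.IsSmoothlySlice →
      ∃ (X : Type) (_ : TopologicalSpace X) (_ : T2Space X) (_ : ChartedSpace (EuclideanSpace ℝ (Fin 4)) X)
        (_ : IsManifold (𝓡 4) ∞ X) (e : EuclideanSpace ℝ (Fin 4) → X) (f : EuclideanSpace ℝ (Fin 2) → X)
        (q : X) (ι : ↥((⟨{q}ᶜ, isOpen_compl_singleton⟩ : TopologicalSpace.Opens X)) →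
          Metric.sphere (0 : EuclideanSpace ℝ (Fin 5)) 1),
        K'.IsSliceDiscIn X e f ∧ q ∉ range e ∧ q ∉ range f ∧
          Manifold.IsSmoothEmbedding (𝓡 4) (𝓡 4) ∞ ι) :
    ∀ (K K' : Knot) (Y : Type) [TopologicalSpace Y] [ChartedSpace (EuclideanSpace ℝ (Fin 3)) Y],
      IsIntegralSurgery (𝓡 3) Y K 0 → IsIntegralSurgery (𝓡 3) Y K' 0 → K.IsSmoothlySlice →
        K'.IsSmoothlySlice := by
  intro K K' Y _ _ h1 h2 h3
  obtain ⟨X, _, _, _, _, e, f, q, ι, hef, hqe, hqf, hι⟩ := h K K' Y h1 h2 h3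
  exact isSmoothlySlice_of_isSliceDiscIn_of_punctureEmbeds_sphere hef hqe hqf hι

/-- **KILL SWITCH ⇒ HEIGHT-ZERO BET** (the converse; so the two are equivalent). Unconditional. [folklore] -/
theorem heightZeroBet_of_zeroSurgeryDeterminesSliceness
    (hA : ∀ (K K' : Knot) (Y : Type) [TopologicalSpace Y] [ChartedSpace (EuclideanSpace ℝ (Fin 3)) Y],
      IsIntegralSurgery (𝓡 3) Y K 0 → IsIntegralSurgery (𝓡 3) Y K' 0 → K.IsSmoothlySlice →
        K'.IsSmoothlySlice) :
    ∀ (K K' : Knot) (Y : Type) [TopologicalSpace Y] [ChartedSpace (EuclideanSpace ℝ (Fin 3)) Y],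
      IsIntegralSurgery (𝓡 3) Y K 0 → IsIntegralSurgery (𝓡 3) Y K' 0 → K.IsSmoothlySlice →
      ∃ (X : Type) (_ : TopologicalSpace X) (_ : T2Space X) (_ : ChartedSpace (EuclideanSpace ℝ (Fin 4)) X)
        (_ : IsManifold (𝓡 4) ∞ X) (e : EuclideanSpace ℝ (Fin 4) → X) (f : EuclideanSpace ℝ (Fin 2) → X)
        (q : X) (ι : ↥((⟨{q}ᶜ, isOpen_compl_singleton⟩ : TopologicalSpace.Opens X)) →
          Metric.sphere (0 : EuclideanSpace ℝ (Fin 5)) 1),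
        K'.IsSliceDiscIn X e f ∧ q ∉ range e ∧ q ∉ range f ∧
          Manifold.IsSmoothEmbedding (𝓡 4) (𝓡 4) ∞ ι :=
  fun K K' Y _ _ h1 h2 h3 ↦ exists_punctureEmbeds_of_isSmoothlySlice (hA K K' Y h1 h2 h3)

/-- **A counterexample to the crux lives on a non-Schoenflies sphere.**  Given Rasmussen's Theorem 1
(named fact `eq_zero_of_isSmoothlySlice`), if `SVanishesOnPairs` fails then some `0`-surgery pair
`(K, K', Y)` with `K` slice and `s(K') = s ≠ 0` has `K'` slice only in ambients NO puncture of which embeds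
in `S⁴` — in particular the Manolescu–Piccirillo homotopy sphere of the pair (for every slice disc and
identification) is exotic and not of the form `B ∪_∂ B⁴` with `B ⊂ S⁴`. [cite: FreedmanGompfMorrisonWalker2010, §1] -/
theorem not_sVanishesOnPairs_witness_not_schoenflies (hR : eq_zero_of_isSmoothlySlice)
    (h : ¬ SVanishesOnPairs) :
    ∃ (K K' : Knot) (Y : Type) (_ : TopologicalSpace Y) (_ : ChartedSpace (EuclideanSpace ℝ (Fin 3)) Y)
      (s : ℤ), IsIntegralSurgery (𝓡 3) Y K 0 ∧ IsIntegralSurgery (𝓡 3) Y K' 0 ∧ K.IsSmoothlySlice ∧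
        K'.HasRasmussenInvariant s ∧ s ≠ 0 ∧
        ∀ (X : Type) [TopologicalSpace X] [T2Space X] [ChartedSpace (EuclideanSpace ℝ (Fin 4)) X]
          [IsManifold (𝓡 4) ∞ X] (e : EuclideanSpace ℝ (Fin 4) → X) (f : EuclideanSpace ℝ (Fin 2) → X)
          (q : X) (ι : ↥((⟨{q}ᶜ, isOpen_compl_singleton⟩ : TopologicalSpace.Opens X)) →
            Metric.sphere (0 : EuclideanSpace ℝ (Fin 5)) 1),
          K'.IsSliceDiscIn X e f → q ∉ range e → q ∉ range f →
            ¬ Manifold.IsSmoothEmbedding (𝓡 4) (𝓡 4) ∞ ι := by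
  obtain ⟨K, K', Y, _, _, s, h1, h2, h3, h4, h5⟩ := not_not.1 (mt not_crux_iff_sVanishesOnPairs.1 h)
  refine ⟨K, K', Y, _, _, s, h1, h2, h3, h4, h5, fun X _ _ _ _ e f q ι hef hqe hqf ↦ ?_⟩
  exact not_punctureEmbeds_sphere_of_not_isSmoothlySlice (fun h6 ↦ h5 (hR h4 h6)) hef hqe hqf ι

/-- **The FGMW strategy needs a non-Schoenflies sphere**: given Rasmussen's Theorem 1, a knot slice in a
homotopy ball with `s ≠ 0` (the registered open `FGMWRasmussenStrategy`) is slice only in ambients no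
puncture of which embeds in `S⁴`; homotopy spheres `B ∪_∂ B⁴` with `B` a Schoenflies ball can never carry
the strategy, whether or not `B` is standard. [cite: FreedmanGompfMorrisonWalker2010, §1] -/
theorem fgmwRasmussenStrategy_sphere_not_schoenflies (hR : eq_zero_of_isSmoothlySlice)
    (h : Literature.Barriers.SmoothPoincare4.FGMWRasmussenStrategy) :
    ∃ (K : Knot) (s : ℤ), K.IsHomotopyBallSlice ∧ K.HasRasmussenInvariant s ∧ s ≠ 0 ∧
      ∀ (X : Type) [TopologicalSpace X] [T2Space X] [ChartedSpace (EuclideanSpace ℝ (Fin 4)) X]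
        [IsManifold (𝓡 4) ∞ X] (e : EuclideanSpace ℝ (Fin 4) → X) (f : EuclideanSpace ℝ (Fin 2) → X)
        (q : X) (ι : ↥((⟨{q}ᶜ, isOpen_compl_singleton⟩ : TopologicalSpace.Opens X)) →
          Metric.sphere (0 : EuclideanSpace ℝ (Fin 5)) 1),
        K.IsSliceDiscIn X e f → q ∉ range e → q ∉ range f →
          ¬ Manifold.IsSmoothEmbedding (𝓡 4) (𝓡 4) ∞ ι := by
  obtain ⟨K, hK, s, hs, hs0⟩ := h
  exact ⟨K, s, hK, hs, hs0, fun X _ _ _ _ e f q ι hef hqe hqf ↦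
    not_punctureEmbeds_sphere_of_not_isSmoothlySlice (fun h6 ↦ hs0 (hR hs h6)) hef hqe hqf ι⟩

end Summit.SmoothPoincare4.SmoothPoincare4.Theorems.ZseSVanishesOnPairs.Negative

end
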